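import Summits.CriticalPhenomena.CardyFormulaZ2.Theorems.CardyMagicRigidityPositiveConeDefs
import Summits.CriticalPhenomena.CardyFormulaZ2.Theorems.CardyMagicRigidityPositiveConeJointDefs
import Summits.CriticalPhenomena.CardyFormulaZ2.Theorems.CardyMagicRigidityNestingRigidityPgfUniqueness
import Summits.CriticalPhenomena.CardyFormulaZ2.Theorems.CardyMagicRigidityNestingRigidityConeLever
import Summits.CriticalPhenomena.CardyFormulaZ2.Theorems.CardyMagicRigidityNestingRigidityWeightDoublingAlgebra
import Summits.CriticalPhenomena.CardyFormulaZ2.Theorems.CardyMagicRigidityNestingRigidityStaircaseCloud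
import Summits.CriticalPhenomena.CardyFormulaZ2.Theorems.CardyMagicRigidityNestingRigidityPressureCalibration
import Summits.CriticalPhenomena.CardyFormulaZ2.Theorems.CardyMagicRigidityNestingRigidityUVLinearisation
import Summits.CriticalPhenomena.CardyFormulaZ2.Theorems.CardyMagicRigidityNestingRigidityHoelderReduction
import Summits.CriticalPhenomena.CardyFormulaZ2.Theorems.CardyMagicRigidityNestingRigidityTowerMomentLower
import Summits.CriticalPhenomena.CardyFormulaZ2.Theorems.CardyMagicRigidityNestingRigidityTowerMomentUpper
import Summits.CriticalPhenomena.CardyFormulaZ2.Theorems.CardyMagicRigidityNestingRigidityUVExpMomentsChargeFree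
import Summits.CriticalPhenomena.CardyFormulaZ2.Theorems.CardyMagicRigidityNestingRigidityUVDecoupling
import Summits.CriticalPhenomena.CardyFormulaZ2.Theorems.CardyMagicRigidityNestingRigidityJointPgfUniqueness
import Summits.CriticalPhenomena.CardyFormulaZ2.Theorems.CardyMagicRigidityNestingRigidityTreeRigidityFamilySwitch
import Summits.CriticalPhenomena.CardyFormulaZ2.Theorems.CardyMagicRigidityNestingRigidityTreeRigidityReconstruction
import Summits.CriticalPhenomena.CardyFormulaZ2.Theorems.CardyMagicRigidityNestingRigidityPrecompactnessReduction
import Summits.CriticalPhenomena.CardyFormulaZ2.Theorems.CardyMagicRigidityNestingRigidityTransferReduction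
import Summits.CriticalPhenomena.CardyFormulaZ2.Theorems.CardyMagicRigidityNestingRigidityTransferRigidity
import Summits.CriticalPhenomena.CardyFormulaZ2.Theorems.CardyMagicRigidityNestingRigidityRegularNotRigid
import Literature.Barriers.CriticalPhenomena.NestingTransformBlindness

/-!
# Skeleton line `positive-cone-weight-doubling` for crux `NestingRigidity` (stmt-CriticalPhenomena-4835) — r4

Route `CardyMagicRigidity`, crux r3 `NestingRigidity ≡ MagicFormulaZ2 → MagicFormulaT → LoopLimitZ2EqT`
(literally, `Iff.rfl`).  Lead reshape r3 (seventh lead seat `prover-line-stmt-CriticalPhenomena-4835-c4-0`,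
2026-08-16T22Z) of seat -2's r2 (`Lines/positive_cone_weight_doubling.lean`, sha bc7e484a; planner's
checked skeleton `Lines/positive-cone-weight-doubling.lean`).  CONCURRENT with the live lead c3-0 of line
`ring-cloud-tomography` (skeleton r6): the two n = 1 stubs below are c3-0's registered statements VERBATIM
(shared stubs — whoever lands them closes the n = 1 layer of both lines), registration is additive
(`workitem stub-add`; no `skeleton check` sweep while c3-0 is live), and this seat's own contributions are
(i) an UNTILTED route to `UVDecoupling` (helper stubs [A] [B] [C] below) and (ii) the Transfer complex
(`stub_precompactness`, `stub_treeRigidity`).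

## The line (idea card `Ideas/positive-cone-weight-doubling.md`; line card `Lines/positive-cone-weight-doubling.md`)

THE LEVER (n = 1).  `MagicFormulaZ2` ⇒ `zEns.CloudLaw` (`cloudLaw_zEns_of`, …ConeLever p107226); the cone
cloud `{disc (0,r,t), ring (0,1,2,−t)}` has Gaussian exponent `t²(log r + C₀)` EXACTLY; for `|t| < π/6` every
loop weight is `≥ 0`, the tower carries `w(t)^{N_0(r,1)}`, the rest the UV drift — `ConeTiltLaw zEns` follows
from the pure loop-side estimate `UVDecoupling zEns` (`coneTiltLaw_of_cloudLaw`).  WEIGHT DOUBLING at the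
partner charge is realised by STAIRCASE clouds (`Staircase.partnerTilt_of_decoupling`, p110700) and the landed
calibration (`stub_pressureCalibration`, p106959) gives `NestingDensity zEns`, `ν = 1/(2π√3)`.
THE IDENTIFICATION (n ≥ 2): `stub_ringTomography` (HARDEST, XL, lead-held: the crux's open content) ⇒
`PositiveTiltAgreement`; `stub_pgfUniqueness` LANDED (p101312) ⇒ `LawAgreementAt`; `stub_precompactness` (L–XL):
`PrecompactRegular zEns ∧ PrecompactRegular tEns`; `stub_treeRigidity` (L): regular limits + `NestingLawAgreement`
⇒ `d_CN(bond_{δₖ}, site_{δₖ}) → 0`.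

    NestingRigidity ⇐ stub_uvDecoupling ∧ stub_staircaseDecoupling       (n = 1, shared with ring-cloud R1'/R2')
                     ∧ stub_ringTomography                               (n ≥ 2: tilted moments agree; HARDEST, held)
                     ∧ stub_pgfUniqueness (LANDED)                       (tilted moments ⇒ count laws)
                     ∧ stub_precompactness ∧ stub_treeRigidity           (count laws + regularity ⇒ d_CN)

## Lead reshape r3 (this seat) — the untilted route to `UVDecoupling` (helper stubs, `stub-add`)

c3-0's route to R1' (`uvDecoupling_of_collar_bounds`, p126379) needs TILTED statements without slack
((HK) tilted collar bound, (U) tilted exponential concentration).  Since `UVDecoupling` tolerates `r^{±η}`,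
Hölder in the tower weight removes the tilt:
* [C] `uvDecoupling_of_untilted_bounds` (pure analysis, THIS SEAT): with `w = magicWeight t`, `N = N_0(r,1)`,
  `M(v) = E_δ[v^N]`, `m = E_δ N`, `Θ = Σ_{u ∉ tower} θ_u`, `Θ₂ = Σ θ_u²` and the landed pathwise sandwich
  `w^N e^{−√3Θ − Θ₂/cos(|t|+π/3)} ≤ A ≤ w^N e^{−√3Θ}` (`UVLinear.finprod_nestingFactor_mem_Icc`) and EXACT
  centring `E_δ Θ = −t m` (`integral_uvPhase_latticeEnsembles`, p126196):
  UPPER `E[w^N e^{−√3(Θ+tm)}] ≤ M(w^p)^{1/p} · E[e^{−q√3(Θ+tm)}]^{1/q}` (Hölder) and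
  `M(w^p)^{1/p} ≤ M(w)^{λ/p} M(w²)^{(1−λ)/p} ≤ r^{−η/2} M(w)` (Hölder between the bases `w`, `w²`,
  `λ = 2 − p`, and the a-priori bounds `M(w) ≥ r^{C}`, `M(w²) ≤ r^{−C}`, for `p − 1 ≤ η/(6C)`);
  LOWER `E[w^N e^{Y}] ≥ M(w^{1/p})^{p} / E[e^{−Y/(p−1)}]^{p−1}` (reverse Hölder), `M(w^{1/p}) ≥ min(M(w), 1)`,
  `M(w) ≤ M(w^{1/p})^{p/(2p−1)} M(w²)^{(p−1)/(2p−1)}`.  So `UVDecoupling E` follows from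
* [A] `uvExpMoments_latticeEnsembles`: UNTILTED exponential moments of ALL orders of `Θ + t m` (both signs)
  and of `Θ₂`, bounded uniformly in small `r` and then small meshes (multi-scale: scale-localised loop
  functionals are finite-range dependent; all-order exponential moments of big-loop counts by thin covering +
  disjoint witnesses + BK; Orlicz summation across scales — K1/K2 machinery p125372/p126008), and
* [B] `towerMoment_lower_latticeEnsembles` (RSW–FKG polychromatic two-arm LOWER bound:
  `P_δ[N_0(r,1) = 0] ≥ r^{C}`) and `towerMoment_upper_latticeEnsembles` (`E_δ[v^{N_0(r,1)}] ≤ r^{−C}` for every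
  `v > 1`: BK across dyadic inradius shells of the nested chain; cousin of c3-0's keystone K5).
STATUS (wave 1): [C] LANDED (`…HoelderToolkit` p128310 + `…HoelderReduction` p128475, `uvDecoupling_of_untilted_bounds`);
[B-low] LANDED (`…TowerMomentLower` p128174: Jensen `w^{meanTower} ≤ towerMoment` + K1 ⇒ `meanTower_le_log_latticeEnsembles`,
the a-priori upper half of `NestingDensity`); [A], [B-up], K6 `expMoment_ncard_bigLoops_le` in progress.  Hence
`stub_uvDecoupling` ⇐ [A] ∧ [B-up], sorry-free: `uvDecoupling_of_helpers` below.

## Transfer complex (this seat's second target)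

`stub_treeRigidity`'s intended proof is refuted AS A PRINCIPLE by `exists_regular_patternCount_eq_not_isClose`
(…RegularNotRigid p120899: `Regular` + equal statistics ⇏ `d_CN`, figure-eights); the stub itself (about the two
lattice limits) is not refuted.  Repair planned after the audit worker reports: strengthen the support predicate
passed to the limit by `stub_precompactness` (single-signed winding + trace-determinacy of the unbased loop) and use
the landed reconstruction (…TransferReconstruction p114726, …TransferRigidity p118827, …TransferSimpleLoops p125567).
`stub_precompactness`: Aizenman–Burchard `d_CN`-precompactness on both lattices from the tree's AB criterion
(`isTightMeasureSet_of_traversalBounds`) + K1 loop-number tightness; regular representative of the limit.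

## Lead reshape r4 (this seat, after wave 1 — 33 modules landed, 2026-08-16T23Z)

n = 1: [C] (p128310, p128475), [B-low] (p128174), [B-up] (p129280, 5 modules), K6 (p129068, 4 modules) LANDED;
[A] reduced by its worker (6 modules, …UVExpMomentsCell/Assembly/Indep/Reduction/ChargeFree/Dilation) to three
CHARGE-FREE inputs — registered helpers `uvFarBite_expMoment_latticeEnsembles` (Ξ: centred exponential moments,
all real orders, of `Σ_far (φ_u − ψ_u)`), `uvFarBiteSq_expMoment_latticeEnsembles` (Ξ₂), `uvCollar_expMoment_latticeEnsembles`
(K) — so `stub_uvDecoupling ⇐ Ξ ∧ Ξ₂ ∧ K` sorry-free (`uvDecoupling_of_chargeFree` below).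
Transfer: `stub_treeRigidity` is MISSTATED as a principle in two certified ways — (G1) `Regular` is not
winding-rigid across configurations (p120899) and (G2) family-by-family `NestingLawAgreement` does not determine
the JOINT count law (NEW witness `exists_regular_laws_familywise_eq_jointly_ne`, …TreeRigidityFamilySwitch p129546:
needled Regular loops hidden by cut discs; cnLawEDist ≥ 1/2) — plus (G3) missing measurability (audit
`work/stubs/TreeRigidity-audit.md`).  REPAIR (this reshape, 7 stubs): the identification milestone becomes JOINT
over finitely many disc families (`JointPositiveTiltAgreement` — natural for tomography: a superposition of clouds
is a cloud), PGF uniqueness its joint form (`stub_jointPgfUniqueness`, M, provable now), types are carried ON THE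
LATTICE (`stub_typedJointAgreement : JointNestingLawAgreement → TypedJointNestingLawAgreement`: exact alternation
`typeAlternation_*`, swap symmetry p129845, common ancestors), precompactness must deliver TAME regular limits with
measurable presentations (`stub_tamePrecompactness`; 3 of 5 `Regular` fields of every limit presentation already
PROVED: p128987/p129158/p129600; glue p128809/p129294/p129759/p129890), and tree rigidity is restated on tame
supports with typed joint statistics (`stub_treeRigidityTame`; its law-level glue is landed: p128704, p129918,
p130005 — what it still needs is the pure-topology `tame_rigidity`, registered helper).  Vocabulary + glue: LANDED definitions
module `Theorems/CardyMagicRigidityPositiveConeJointDefs.lean` (p130599).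

## Wave 2 (23:15–00:10Z) and the END OF THE LINE

LANDED: R1' `stub_uvDecoupling` (…UVDecoupling p133026, both lattices: [C] p128475 ∘ [A] p129762 (Ξ …UVFarBite p132797, Ξ₂ …UVFarBiteSq
p132341, K …UVCollar p132406) ∘ [B] p128174/p129280) and with it `coneScaling : ConeScaling` (STUB 1 of this line: `MagicFormulaZ2 →
ConeTiltLaw zEns`); S4' `stub_jointPgfUniqueness` (…JointPgfUniqueness p130968); K5 `towerCount_expMoment_bound` (…TowerCountExpMoment p131115,
the ring-cloud lead's keystone, from [B-up] + dilation); soft-machine / assembly / K6-at-all-centres bricks (…SoftMachine*, …TreeRigidityTameAssembly*,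
…BigLoopsExpMomentBall/Meet*, …SiteTranslation).
DEAD: the registered helper `tame_rigidity` is REFUTED (…TameRigidityWitness p132831 `exists_tame_wind_eq_ne`, `not_tame_rigidity`: the TWO-MOUTH
LAKE — two tame loops with the same winding function at distance ≥ 1/2; law level …TameRigidityLaws p133027).  Mechanism (G4, ROUTING BLINDNESS):
re-routing a loop at a crossing chord pair preserves (trace, W, type); the routing records the NECK TYPE (which side of a pinch is connected), which no
nesting transform, tower/pattern count or typed interior statistic sees, and both neck types occur in the lattice limits.  Hence `stub_treeRigidityTame`
(and ring-cloud's `stub_transfer`, markov-cascade's `stub_cascadeReconstruction`) need neck-type universality, which nothing in any line supplies: the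
transfer step of EVERY line of this crux is dead in `d_CN`.  Dossier: `Lines/positive-cone-weight-doubling-dead.md`.  What survives verbatim under a
routing-blind target: everything landed, in particular the routing-blind assembly …TreeRigidityTameAssemblyInteriors p132016 / …TameAssembly p132337 /
…TameAssemblyClass p132752.

## Disproof used (`Cruxes/NestingRigidity/Disproof.lean` v1.3 = landed barrier `NestingTransformBlindness`, p68977)

(i) TYPE-blindness: no stub reads types off a transform; types enter only in `stub_treeRigidity`, from the lattice.
(ii) POINT-LOOP blindness: `Regular.boundary`; note `d_CN` itself does not see point loops (diameter `< ε` never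
matched), so regularity is a property of a REPRESENTATIVE of the limit law — `PrecompactRegular`'s `∃ X` form is the
right one.  (iii) COVERING blindness: `Regular.degreeOne`.  (iv)+(§5) CLE₃⊔CLE₃ impostor: passes every n = 1
statement; excluded only in `stub_ringTomography` (hypotheses = the two LATTICE magic formulas) — the crux's open
content, held by the lead.  No `_false_without_` theorem exists for this crux; Targets (v1.3) name no stub here.
-/

noncomputable section

open MeasureTheory Filter Set Topology
open scoped Real ENNReal BigOperators
open Literature.Probability.RandomPlanarGeometry Literature.Probability.Percolation
  Literature.Probability.LatticeModels
open Summit.CriticalPhenomena.CardyFormulaZ2.Theses.CardyMagicRigidity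
open Summit.CriticalPhenomena.CardyFormulaZ2.Cruxes.NestingRigidity.RingCloudTomography

namespace Summit.CriticalPhenomena.CardyFormulaZ2.Cruxes.NestingRigidity.PositiveConeWeightDoubling

/-! ### r4 vocabulary: `Tame`, `typedPatternCount`, `jointTilt`, `jointCyl`, the JOINT/TYPED milestones, `TamePrecompact`,
`TreeRigidityTame` and the glue `nestingRigidity_of_statements_r4` are the LANDED definitions module
`Theorems/CardyMagicRigidityPositiveConeJointDefs.lean` (p130599), imported. -/

/-! ### The registered stubs (the only sorries of the file) -/

/-! STUB 1' `stub_uvDecoupling : ∀ E ∈ latticeEnsembles, UVDecoupling E` is **LANDED** (…UVDecoupling p133026, wave 2 of this seat: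
[C] p128475 ∘ [A] p129762 (Ξ p132797, Ξ₂ p132341, K p132406) ∘ [B] p128174/p129280) — imported, no sorry; with it `coneScaling :
ConeScaling` (STUB 1 of the line) is landed too. -/

example : ∀ E ∈ latticeEnsembles, UVDecoupling E := stub_uvDecoupling
example : ConeScaling := coneScaling

/-- STUB 2' (L) — **staircase decoupling on both lattices** (ring-cloud R2' VERBATIM, shared registration): the
hypothesis of the landed `Staircase.partnerTilt_of_decoupling` (p110700). -/
theorem stub_staircaseDecoupling : ∀ E ∈ latticeEnsembles,
    ∀ t ∈ Set.Ioo (-(5 * π / 6)) (-(π / 2)), ∀ η : ℝ, 0 < η →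
      ∃ (k : ℕ) (L M : Fin k → ℝ) (r₀ : ℝ), 0 < k ∧ (∀ j, 0 < L j) ∧ (∀ j, L j < M j) ∧
        (∀ j l, j < l → M j ≤ L l) ∧ 0 < r₀ ∧ (∀ j, r₀ ≤ L j) ∧ ∀ r ∈ Set.Ioo (0 : ℝ) r₀,
          ∀ᶠ δ in 𝓝[>] (0 : ℝ),
            r ^ η * (E.towerMoment (magicWeight t) δ r * Real.exp (Real.sqrt 3 * t * meanTower E δ r)) ≤
                ∫ ω, (E.X δ ω).nestingWeight (Cloud.mk 1 k (fun _ ↦ 0) (fun _ ↦ r) (fun _ ↦ t)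
                  (fun _ ↦ 0) L M (fun _ ↦ -t / k)).density ∂E.P ∧
              ∫ ω, (E.X δ ω).nestingWeight (Cloud.mk 1 k (fun _ ↦ 0) (fun _ ↦ r) (fun _ ↦ t)
                  (fun _ ↦ 0) L M (fun _ ↦ -t / k)).density ∂E.P ≤
                r ^ (-η) * (E.towerMoment (magicWeight t) δ r * Real.exp (Real.sqrt 3 * t * meanTower E δ r)) := by
  sorry

/-- STUB 3' (XL, LOAD-BEARING, lead-held) — **ring-cloud tomography, calibrated, JOINT over disc families**: the
crux's open content (identities ⇒ LAWS); a superposition of `J` neutralised clouds is a cloud, so the joint form is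
the natural output. -/
theorem stub_ringTomographyJoint :
    MagicFormulaZ2 → MagicFormulaT → ConeTiltLaw zEns → NestingDensity zEns → JointPositiveTiltAgreement := by
  sorry

/-! STUB 4' `stub_jointPgfUniqueness` is **LANDED** (…JointPgfUniqueness p130968, wave 2: re-indexing of p101312/p98505) — imported. -/

example : ∀ (J n : ℕ) (x : Fin J → Fin n → ℂ) (r : Fin J → Fin n → ℝ) (R : Fin J → ℝ),
    JointTiltAgreementAt J n x r R → JointLawAgreementAt J n x r R := stub_jointPgfUniqueness

/-- STUB 5' (L, lattice) — **types ride on the lattice**: untyped joint agreement implies TYPED joint agreement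
(types alternate along nesting chains EXACTLY on both lattices, the global bit is fair and asymptotically
independent by colour flip / self-duality + half-mesh shift (p129845), and any two loops of a window have a common
ancestor with probability `→ 1` as the outer window grows, RSW circuits). -/
theorem stub_typedJointAgreement : JointNestingLawAgreement → TypedJointNestingLawAgreement := by
  sorry

/-- STUB 6' (XL) — **tame precompactness of both lattice ensembles** (Aizenman–Burchard tightness of the loop FAMILY
in `d_CN` + tame regular representatives with measurable presentations; landed: the T1/T2 splitting and glue, the
soft fields `degreeOne`/`laminar`/`locallyFinite` of every limit presentation, the `tEns` T1 half from
`exists_isFullPlaneCNLLaw`; missing: T1 on `ℤ²`, the hard fields `boundary`/`separating`/`solid`/`atMostDouble`, dust). -/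
theorem stub_tamePrecompactness : TamePrecompact zEns ∧ TamePrecompact tEns := by
  sorry

/-- STUB 7' (L) — **tree rigidity on tame supports with typed joint statistics** (audit §6): law-level glue landed
(p100341 counts' stability, …CriticalRadii, p129918 coupling along equal laws, p130005 typed reconstruction,
p128704 `udist_eq_zero_of_windInjective`, …TransferGluing); missing: the pure-topology `tame_rigidity`
(registered helper `tame_rigidity : ∀ u v, Tame u → Tame v → (∀ z, W u z = W v z) → u = v`, written inline). -/
theorem stub_treeRigidityTame : TreeRigidityTame := by
  sorry

/-! ### n = 1 glue (sorry-free): the line's STUB 1 / STUB 2 statements from the shared stubs -/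

/-- **R1' from the two remaining registered helpers of the untilted route** ([A] `uvExpMoments_latticeEnsembles`,
[B-up] `towerMoment_upper_latticeEnsembles`) through the LANDED [C] (p128475) and [B-low] (p128174) — kept for
the record; after wave 1, [B-up] is landed too (p129280) and [A] is reduced further (`uvDecoupling_of_chargeFree`). -/
theorem uvDecoupling_of_helpers
    (hA : ∀ E ∈ latticeEnsembles,
      ∀ t ∈ Set.Ioo (-(π / 6)) (π / 6), ∀ s : ℝ, 0 < s → ∃ C r₀ : ℝ, 0 < r₀ ∧ ∀ r ∈ Set.Ioo (0 : ℝ) r₀,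
      ∀ᶠ δ in 𝓝[>] (0 : ℝ), ∀ Θ Θ₂ : E.Ω → ℝ,
        (∀ ω, Θ ω = ∑ᶠ u ∈ (E.X δ ω).loops \ {u ∈ (E.X δ ω).loops |
            Metric.closedBall (0 : ℂ) r ⊆ {z | u.wind z ≠ 0} ∧ u.range ⊆ Metric.ball (0 : ℂ) 1},
            u.nestingPhase (coneCloud t r).density) →
        (∀ ω, Θ₂ ω = ∑ᶠ u ∈ (E.X δ ω).loops \ {u ∈ (E.X δ ω).loops |
            Metric.closedBall (0 : ℂ) r ⊆ {z | u.wind z ≠ 0} ∧ u.range ⊆ Metric.ball (0 : ℂ) 1},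
            u.nestingPhase (coneCloud t r).density ^ 2) →
        Integrable (fun ω ↦ Real.exp (s * (Θ ω + t * meanTower E δ r))) E.P ∧
        ∫ ω, Real.exp (s * (Θ ω + t * meanTower E δ r)) ∂E.P ≤ C ∧
        Integrable (fun ω ↦ Real.exp (-(s * (Θ ω + t * meanTower E δ r)))) E.P ∧
        ∫ ω, Real.exp (-(s * (Θ ω + t * meanTower E δ r))) ∂E.P ≤ C ∧
        Integrable (fun ω ↦ Real.exp (s * Θ₂ ω)) E.P ∧
        ∫ ω, Real.exp (s * Θ₂ ω) ∂E.P ≤ C) :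
    ∀ E ∈ latticeEnsembles, UVDecoupling E := fun E hE ↦
  uvDecoupling_of_untilted_bounds E hE (hA E hE) (towerMoment_lower_latticeEnsembles E hE)
    (towerMoment_upper_latticeEnsembles E hE)

/-- **R1' from the three CHARGE-FREE registered helpers** (after wave 1): Ξ `uvFarBite_expMoment_latticeEnsembles`,
Ξ₂ `uvFarBiteSq_expMoment_latticeEnsembles`, K `uvCollar_expMoment_latticeEnsembles` give [A] through the landed
`uvExpMoments_of_chargeFree_bounds` (p129762), hence `stub_uvDecoupling` through the landed [C] (p128475), [B-low]
(p128174) and [B-up] (p129280) — sorry-free. -/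
theorem uvDecoupling_of_chargeFree
    (hΞ : ∀ E ∈ latticeEnsembles, ∀ a : ℝ, ∃ C r₀ : ℝ, 0 < r₀ ∧ ∀ r ∈ Set.Ioo (0 : ℝ) r₀, ∀ᶠ δ in 𝓝[>] (0 : ℝ), ∫ ω, Real.exp (a * ((∑ᶠ u ∈ {u ∈ (E.X δ ω).loops | Disjoint u.range (Metric.closedBall (0 : ℂ) (1 + 2 * δ) \ Metric.ball 0 (r - 2 * δ))}, ((∫ z in {z | u.wind z ≠ 0}, discDensity 0 r z) - ∫ z in {z | u.wind z ≠ 0}, annulusDensity 0 1 2 z)) - ∫ ω', (∑ᶠ u ∈ {u ∈ (E.X δ ω').loops | Disjoint u.range (Metric.closedBall (0 : ℂ) (1 + 2 * δ) \ Metric.ball 0 (r - 2 * δ))}, ((∫ z in {z | u.wind z ≠ 0}, discDensity 0 r z) - ∫ z in {z | u.wind z ≠ 0}, annulusDensity 0 1 2 z)) ∂E.P)) ∂E.P ≤ C)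
    (hΞ₂ : ∀ E ∈ latticeEnsembles, ∀ a : ℝ, 0 < a → ∃ C r₀ : ℝ, 0 < r₀ ∧ ∀ r ∈ Set.Ioo (0 : ℝ) r₀, ∀ᶠ δ in 𝓝[>] (0 : ℝ), ∫ ω, Real.exp (a * ∑ᶠ u ∈ {u ∈ (E.X δ ω).loops | Disjoint u.range (Metric.closedBall (0 : ℂ) (1 + 2 * δ) \ Metric.ball 0 (r - 2 * δ))}, ((∫ z in {z | u.wind z ≠ 0}, discDensity 0 r z) - ∫ z in {z | u.wind z ≠ 0}, annulusDensity 0 1 2 z) ^ 2) ∂E.P ≤ C)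
    (hK : ∀ E ∈ latticeEnsembles, ∀ a : ℝ, 0 < a → ∃ C r₀ : ℝ, 0 < r₀ ∧ ∀ r ∈ Set.Ioo (0 : ℝ) r₀, ∀ᶠ δ in 𝓝[>] (0 : ℝ), ∫ ω, Real.exp (a * ((∑ᶠ u ∈ {u ∈ (E.X δ ω).loops | (u.range ∩ Metric.closedBall (0 : ℂ) r).Nonempty ∧ ¬ u.range ⊆ Metric.ball (0 : ℂ) (r - 2 * δ)}, ∫ z in {z | u.wind z ≠ 0}, discDensity 0 r z) + ({u ∈ (E.X δ ω).loops | Metric.closedBall (0 : ℂ) r ⊆ {z | u.wind z ≠ 0} ∧ ¬ u.range ⊆ Metric.ball (0 : ℂ) 1 ∧ (u.range ∩ Metric.closedBall (0 : ℂ) (1 + 2 * δ)).Nonempty}.ncard : ℝ) + ∑ᶠ u ∈ {u ∈ (E.X δ ω).loops | (u.range ∩ Metric.closedBall (0 : ℂ) (1 + 2 * δ)).Nonempty ∧ ¬ u.range ⊆ Metric.ball (0 : ℂ) 1}, ∫ z in {z | u.wind z ≠ 0}, annulusDensity 0 1 2 z)) ∂E.P ≤ C) :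
    ∀ E ∈ latticeEnsembles, UVDecoupling E := fun E hE ↦
  uvDecoupling_of_untilted_bounds E hE (uvExpMoments_of_chargeFree_bounds E hE (hΞ E hE) (hΞ₂ E hE) (hK E hE))
    (towerMoment_lower_latticeEnsembles E hE) (towerMoment_upper_latticeEnsembles E hE)

/-- STUB 1 `ConeScaling` from the shared R1'. -/
theorem coneScaling_of_uvDecoupling (hUV : ∀ E ∈ latticeEnsembles, UVDecoupling E) : ConeScaling :=
  fun hZ ↦ coneTiltLaw_of_cloudLaw (cloudLaw_zEns_of hZ) (hUV zEns zEns_mem)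

/-- STUB 2 `WeightDoubling` from the shared R2' (staircase glue p110700 + calibration p106959). -/
theorem weightDoubling_of_staircaseDecoupling
    (hS : ∀ E ∈ latticeEnsembles,
    ∀ t ∈ Set.Ioo (-(5 * π / 6)) (-(π / 2)), ∀ η : ℝ, 0 < η →
      ∃ (k : ℕ) (L M : Fin k → ℝ) (r₀ : ℝ), 0 < k ∧ (∀ j, 0 < L j) ∧ (∀ j, L j < M j) ∧
        (∀ j l, j < l → M j ≤ L l) ∧ 0 < r₀ ∧ (∀ j, r₀ ≤ L j) ∧ ∀ r ∈ Set.Ioo (0 : ℝ) r₀,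
          ∀ᶠ δ in 𝓝[>] (0 : ℝ),
            r ^ η * (E.towerMoment (magicWeight t) δ r * Real.exp (Real.sqrt 3 * t * meanTower E δ r)) ≤
                ∫ ω, (E.X δ ω).nestingWeight (Cloud.mk 1 k (fun _ ↦ 0) (fun _ ↦ r) (fun _ ↦ t)
                  (fun _ ↦ 0) L M (fun _ ↦ -t / k)).density ∂E.P ∧
              ∫ ω, (E.X δ ω).nestingWeight (Cloud.mk 1 k (fun _ ↦ 0) (fun _ ↦ r) (fun _ ↦ t)
                  (fun _ ↦ 0) L M (fun _ ↦ -t / k)).density ∂E.P ≤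
                r ^ (-η) * (E.towerMoment (magicWeight t) δ r * Real.exp (Real.sqrt 3 * t * meanTower E δ r))) :
    WeightDoubling :=
  fun hZ hcone ↦ (stub_pressureCalibration zEns zEns_mem hcone
    (Staircase.partnerTilt_of_decoupling (cloudLaw_zEns_of hZ) (hS zEns zEns_mem))).1

/-! ### The composition r4: the seven stubs imply the crux, by name (glue `nestingRigidity_of_statements_r4`, p130599) -/

/-- **Positive-cone weight doubling closes `NestingRigidity`** — skeleton theorem r4: concludes the crux BY NAME
from the seven registered stubs (only they carry `sorry`). -/
theorem NestingRigidity_of :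
    Summit.CriticalPhenomena.CardyFormulaZ2.Theses.CardyMagicRigidity.NestingRigidity :=
  nestingRigidity_of_statements_r4 coneScaling
    (weightDoubling_of_staircaseDecoupling stub_staircaseDecoupling) stub_ringTomographyJoint
    stub_jointPgfUniqueness stub_typedJointAgreement stub_tamePrecompactness stub_treeRigidityTame

/-! ### Consistency checks (sorry-free) -/

/-- The old single-family milestones are the `J = 1` slices of the joint ones (recorded informally; the landed
`stub_pgfUniqueness` p101312 is the `J = 1` case of `stub_jointPgfUniqueness`). -/
example : PGFUniqueness := stub_pgfUniqueness

/-- Awareness check against the landed negatives (barrier `NestingTransformBlindness`). -/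
example : Literature.Barriers.CriticalPhenomena.NestingTransformBlindness :=
  Literature.Barriers.CriticalPhenomena.nestingTransformBlindness_holds

/-- Awareness checks against the two route-gap theorems: `Regular` + equal statistics ⇏ `d_CN`-close (p120899),
and family-by-family law agreement ⇏ joint law agreement (p129546). -/
example := @exists_regular_patternCount_eq_not_isClose
example := @exists_regular_laws_familywise_eq_jointly_ne

/-- Landed law-level glue of the reshaped Transfer complex (records). -/
example := @cnEDist_untyped_eq_zero_of_counts_eq
example := @precompactRegular_of_limits

/-- The landed sibling glue: `Transfer` from `Precompactness` + statistics-form tree rigidity (p112841). -/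
example := @transfer_of_precompactness

end Summit.CriticalPhenomena.CardyFormulaZ2.Cruxes.NestingRigidity.PositiveConeWeightDoubling

end
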